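import Summits.Parity.GeneralizedHardyLittlewood.Theorems.PrimeLevelFamEdgeMomentsBeyondDiagonalDiagOrderSelberg
import Summits.Parity.GeneralizedHardyLittlewood.Theorems.PrimeLevelFamEdgeMomentsBeyondDiagonalDiagBoseOuter
import Summits.Parity.GeneralizedHardyLittlewood.Theorems.PrimeLevelFamEdgeMomentsBeyondDiagonalDiagBoseSymm
import HarnessLib

/-!
# Route `PrimeLevelFamEdge`, crux K_A `MomentsBeyondDiagonal` (stmt-Parity-20007), line «petersson_layers» v4, stub `stub_diag`:
# **ORDER SYMMETRY `Sel_{ij} = Sel_{ji}` of the per-order targets, and `SubDiag` from the targets with `i ≤ j` only**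

The remaining target list of `stub_diag` (`…DiagOrderSelberg.subDiag_of_selbergOrderAsymptotics`) is indexed by the orders
`(i,j) ≠ (0,0)` with `i+j` even. The order-`(i,j)` inner Selberg form
`Sel_{ij} = Σ_cΣ_g μ(g)c Σ_{k₁,k₂} y′y′ Σ_{d∣k₁,e∣k₂} ∫(log(Q/n₁)+log u₁)^i ∫_{u₂>n₁n₂/(Q²u₁)} B (log(Q/n₂)+log u₂)^j`
(`n₁ = (k₁/d)(ge)`, `n₂ = (gd)(k₂/e)`) is SYMMETRIC in `(i,j)`: swap `k₁ ↔ k₂`, `d ↔ e` (which swaps `n₁ ↔ n₂`) and use the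
symmetry of the shifted Bose weight `𝔚_{ij}(A₁,A₂;y) = 𝔚_{ji}(A₂,A₁;y)` (Fubini on `{u₁u₂ > y}`: `…DiagBoseSymm.bose_coeff_symm`
through `…DiagBoseOuter.bose_expand`). Consequences:

* `boseWeight_symm` — `∫(A₁+log u₁)^i∫_{y/u₁}B(A₂+log u₂)^j = ∫(A₂+log u₁)^j∫_{y/u₁}B(A₁+log u₂)^i` (`y > 0`);
* `heckeSum_order_symm` — the divisor double sum at `(i,j;k₁,k₂)` equals the one at `(j,i;k₂,k₁)` (`Q > 0`, `g,k₁,k₂ ≥ 1`);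
* `selbergOrder_symm` — **`Sel_{ij} = Sel_{ji}`** (`Q > 0`, any `P`, `M`, `N`);
* `subDiag_of_selbergOrderAsymptotics_of_le` — **`SubDiag` follows from the real per-order targets for the orders with
  `i ≤ j` only** (`(i,j) ≠ (0,0)`, `i+j` even, `τ₀₀ = secondMomentForm Δ′ P 1/2`), the functional being extended by
  `τ_{ji} := τ_{ij}`: rung `N` of the ladder needs the orders `(i,N)`, `i ≤ N`, `i ≡ N (mod 2)` on top of rung `N−1`
  (e.g. rung 2 = `(0,2)` and `(2,2)`; `(2,0)` is free).

Def-free; theorems only. Helper `--supports stmt-Parity-20007`; closes nothing; K_A, K_B and the Parity summit are NOT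
proved; nothing about Landau–Siegel zeros.

## References
* E. Kowalski, P. Michel, J. VanderKam, J. reine angew. Math. 526 (2000), (21)–(28) pp. 12–15.
  [cite: KowalskiMichelVanderKam2000, (23)–(28) pp. 13–15 — derivation (symmetry of the diagonal residues in the two variables)]
-/

noncomputable section

open scoped Real ArithmeticFunction.Moebius
open MeasureTheory Polynomial Finset ArithmeticFunction Set
open Literature.NumberTheory.LFunctions

namespace Summit.Parity.GeneralizedHardyLittlewood.Theorems.MomentsBeyondDiagonal.DiagLines

open Summit.Parity.GeneralizedHardyLittlewood.Theorems.PrimeLevelFamEdgeIdeaDeltas.PeterssonLayers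
  (diagPart HasShape SubOf SubDiag)

/-! ### Symmetry of the shifted Bose weight -/

/-- **`𝔚_{ij}(A₁,A₂;y) = 𝔚_{ji}(A₂,A₁;y)`**: `∫_{u₁>0}(A₁+log u₁)^i∫_{u₂>y/u₁}B(u₁+u₂)(A₂+log u₂)^j =
∫_{u₁>0}(A₂+log u₁)^j∫_{u₂>y/u₁}B(u₁+u₂)(A₁+log u₂)^i` for `y > 0` (binomial expansion + `c_{ab} = c_{ba}`). [folklore] -/
theorem boseWeight_symm {y : ℝ} (hy : 0 < y) (i j : ℕ) (A₁ A₂ : ℝ) :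
    ∫ u₁ in Ioi (0 : ℝ), (A₁ + Real.log u₁) ^ i *
        ∫ u₂ in Ioi (y / u₁), Real.exp (-(u₁ + u₂)) / (1 - Real.exp (-(u₁ + u₂))) ^ 2 * (A₂ + Real.log u₂) ^ j =
      ∫ u₁ in Ioi (0 : ℝ), (A₂ + Real.log u₁) ^ j *
        ∫ u₂ in Ioi (y / u₁), Real.exp (-(u₁ + u₂)) / (1 - Real.exp (-(u₁ + u₂))) ^ 2 * (A₁ + Real.log u₂) ^ i := by
  rw [bose_expand hy i j, bose_expand hy j i, Finset.sum_comm (s := Finset.range (j + 1))]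
  refine Finset.sum_congr rfl fun a _ ↦ Finset.sum_congr rfl fun b _ ↦ ?_
  rw [bose_coeff_symm hy b a]
  ring

/-! ### Symmetry of the Hecke-summed order-`(i,j)` weight and of the Selberg form -/

/-- **The divisor double sum of the order-`(i,j)` weight at `(k₁,k₂)` equals that of the order-`(j,i)` weight at `(k₂,k₁)`**
(`Q > 0`, `g, k₁, k₂ ≥ 1`): swap `d ↔ e` (so `n₁ ↔ n₂`) and apply `boseWeight_symm`.
[cite: KowalskiMichelVanderKam2000, (23)–(28) — derivation] -/
theorem heckeSum_order_symm (i j : ℕ) {Q : ℝ} (hQ : 0 < Q) {g k₁ k₂ : ℕ} (hg : g ≠ 0) (hk₁ : k₁ ≠ 0) (hk₂ : k₂ ≠ 0) :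
    ∑ d ∈ k₁.divisors, ∑ e ∈ k₂.divisors,
        ∫ u₁ in Ioi (0 : ℝ),
          (Real.log (Q / ((k₁ / d * (g * e) : ℕ) : ℝ)) + Real.log u₁) ^ i *
          ∫ u₂ in Ioi ((((k₁ / d * (g * e) * (g * d * (k₂ / e)) : ℕ) : ℝ) / Q ^ 2) / u₁),
            Real.exp (-(u₁ + u₂)) / (1 - Real.exp (-(u₁ + u₂))) ^ 2 *
            (Real.log (Q / ((g * d * (k₂ / e) : ℕ) : ℝ)) + Real.log u₂) ^ j =
      ∑ d ∈ k₂.divisors, ∑ e ∈ k₁.divisors,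
        ∫ u₁ in Ioi (0 : ℝ),
          (Real.log (Q / ((k₂ / d * (g * e) : ℕ) : ℝ)) + Real.log u₁) ^ j *
          ∫ u₂ in Ioi ((((k₂ / d * (g * e) * (g * d * (k₁ / e)) : ℕ) : ℝ) / Q ^ 2) / u₁),
            Real.exp (-(u₁ + u₂)) / (1 - Real.exp (-(u₁ + u₂))) ^ 2 *
            (Real.log (Q / ((g * d * (k₁ / e) : ℕ) : ℝ)) + Real.log u₂) ^ i := by
  rw [Finset.sum_comm (s := k₂.divisors)]
  refine Finset.sum_congr rfl fun d hd ↦ Finset.sum_congr rfl fun e he ↦ ?_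
  -- `d ∣ k₁`, `e ∣ k₂`; on the right the roles are `k₂/e·(g d) = n₂`, `g e·(k₁/d) = n₁`
  have h1 : k₂ / e * (g * d) = g * d * (k₂ / e) := by ring
  have h2 : g * e * (k₁ / d) = k₁ / d * (g * e) := by ring
  have h3 : g * d * (k₂ / e) * (k₁ / d * (g * e)) = k₁ / d * (g * e) * (g * d * (k₂ / e)) := by ring
  rw [h1, h2, h3]
  have hy : 0 < (((k₁ / d * (g * e) * (g * d * (k₂ / e)) : ℕ) : ℝ) / Q ^ 2) := by
    have hdk : d ∣ k₁ := (Nat.mem_divisors.1 hd).1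
    have hek : e ∣ k₂ := (Nat.mem_divisors.1 he).1
    have hK : k₁ / d * (g * e) * (g * d * (k₂ / e)) = g * g * (k₁ * k₂) := by
      calc k₁ / d * (g * e) * (g * d * (k₂ / e)) = g * g * ((k₁ / d * d) * (k₂ / e * e)) := by ring
        _ = g * g * (k₁ * k₂) := by rw [Nat.div_mul_cancel hdk, Nat.div_mul_cancel hek]
    rw [hK]
    have h : 0 < g * g * (k₁ * k₂) := by positivity
    have h' : (0 : ℝ) < ((g * g * (k₁ * k₂) : ℕ) : ℝ) := by exact_mod_cast h
    positivity
  exact boseWeight_symm hy i j _ _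

/-- **Order symmetry of the decorated Selberg form: `Sel_{ij} = Sel_{ji}`** (`Q > 0`, any `P`, `M`, `N`): swap
`k₁ ↔ k₂` in the outer double sum and apply `heckeSum_order_symm`. [cite: KowalskiMichelVanderKam2000, (23)–(28) — derivation] -/
theorem selbergOrder_symm (i j : ℕ) (P : ℝ[X]) (M : ℝ) (N : ℕ) {Q : ℝ} (hQ : 0 < Q) :
    ∑ c ∈ Icc 1 N, ∑ g ∈ Icc 1 (N / c), (μ g : ℝ) * c *
        ∑ k₁ ∈ Icc 1 (N / (c * g)), ∑ k₂ ∈ Icc 1 (N / (c * g)),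
          ((μ (c * g * k₁) : ℝ) * ((KMV2000.psi (c * g * k₁))⁻¹ *
              P.eval (Real.log (M / ((c * g * k₁ : ℕ) : ℝ)) / Real.log M)) / ((c * g * k₁ : ℕ) : ℝ)) *
            ((μ (c * g * k₂) : ℝ) * ((KMV2000.psi (c * g * k₂))⁻¹ *
              P.eval (Real.log (M / ((c * g * k₂ : ℕ) : ℝ)) / Real.log M)) / ((c * g * k₂ : ℕ) : ℝ)) *
            ∑ d ∈ k₁.divisors, ∑ e ∈ k₂.divisors,
              ∫ u₁ in Ioi (0 : ℝ),
                (Real.log (Q / ((k₁ / d * (g * e) : ℕ) : ℝ)) + Real.log u₁) ^ i *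
                ∫ u₂ in Ioi ((((k₁ / d * (g * e) * (g * d * (k₂ / e)) : ℕ) : ℝ) / Q ^ 2) / u₁),
                  Real.exp (-(u₁ + u₂)) / (1 - Real.exp (-(u₁ + u₂))) ^ 2 *
                  (Real.log (Q / ((g * d * (k₂ / e) : ℕ) : ℝ)) + Real.log u₂) ^ j =
      ∑ c ∈ Icc 1 N, ∑ g ∈ Icc 1 (N / c), (μ g : ℝ) * c *
        ∑ k₁ ∈ Icc 1 (N / (c * g)), ∑ k₂ ∈ Icc 1 (N / (c * g)),
          ((μ (c * g * k₁) : ℝ) * ((KMV2000.psi (c * g * k₁))⁻¹ *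
              P.eval (Real.log (M / ((c * g * k₁ : ℕ) : ℝ)) / Real.log M)) / ((c * g * k₁ : ℕ) : ℝ)) *
            ((μ (c * g * k₂) : ℝ) * ((KMV2000.psi (c * g * k₂))⁻¹ *
              P.eval (Real.log (M / ((c * g * k₂ : ℕ) : ℝ)) / Real.log M)) / ((c * g * k₂ : ℕ) : ℝ)) *
            ∑ d ∈ k₁.divisors, ∑ e ∈ k₂.divisors,
              ∫ u₁ in Ioi (0 : ℝ),
                (Real.log (Q / ((k₁ / d * (g * e) : ℕ) : ℝ)) + Real.log u₁) ^ j *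
                ∫ u₂ in Ioi ((((k₁ / d * (g * e) * (g * d * (k₂ / e)) : ℕ) : ℝ) / Q ^ 2) / u₁),
                  Real.exp (-(u₁ + u₂)) / (1 - Real.exp (-(u₁ + u₂))) ^ 2 *
                  (Real.log (Q / ((g * d * (k₂ / e) : ℕ) : ℝ)) + Real.log u₂) ^ i := by
  refine Finset.sum_congr rfl fun c _ ↦ Finset.sum_congr rfl fun g hg ↦ ?_
  congr 1
  conv_rhs => rw [Finset.sum_comm]
  refine Finset.sum_congr rfl fun k₁ hk₁ ↦ Finset.sum_congr rfl fun k₂ hk₂ ↦ ?_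
  have hg0 : g ≠ 0 := by have := (Finset.mem_Icc.1 hg).1; omega
  have hk₁0 : k₁ ≠ 0 := by have := (Finset.mem_Icc.1 hk₁).1; omega
  have hk₂0 : k₂ ≠ 0 := by have := (Finset.mem_Icc.1 hk₂).1; omega
  rw [heckeSum_order_symm i j hQ hg0 hk₁0 hk₂0]
  ring

/-! ### `SubDiag` from the targets with `i ≤ j` -/

/-- **`SubDiag` FROM THE REAL PER-ORDER TARGETS WITH `i ≤ j` ONLY** (window `(1, Δ]`, `1 < Δ ≤ 3/2`; orders `(i,j) ≠ (0,0)`,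
`i ≤ j`, `i+j` even; `τ₀₀ = secondMomentForm Δ′ P 1/2`): `…DiagOrderSelberg.subDiag_of_selbergOrderAsymptotics` with the
functional `τ′_{ij} := τ_{min,max}` and the order symmetry `selbergOrder_symm` for `j < i`.
[cite: KowalskiMichelVanderKam2000, (23)–(28) pp. 13–15 — derivation] -/
theorem subDiag_of_selbergOrderAsymptotics_of_le {Δ : ℝ} (hΔ1 : 1 < Δ) (hΔ : Δ ≤ 3 / 2) (τ : ℕ → ℕ → ℝ → ℝ[X] → ℝ)
    (h0 : ∀ (Δ' : ℝ) (P : ℝ[X]), τ 0 0 Δ' P = KMV2000.secondMomentForm Δ' P 1 / 2)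
    (h : ∀ i j : ℕ, i ≤ j → Even (i + j) → ¬(i = 0 ∧ j = 0) → ∀ P : ℝ[X], KMV2000.Admissible P →
      ∀ Δ' : ℝ, 1 < Δ' → Δ' ≤ Δ →
      ∃ C : ℝ, ∃ q₀ : ℕ, ∀ (q : ℕ) [NeZero q], q₀ ≤ q →
        |(Real.log (KMV2000.qhat q))⁻¹ ^ (i + j) * KMV2000.qhat q *
          (∑ c ∈ Icc 1 ⌊KMV2000.qhat q ^ Δ'⌋₊, ∑ g ∈ Icc 1 (⌊KMV2000.qhat q ^ Δ'⌋₊ / c), (μ g : ℝ) * c *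
            ∑ k₁ ∈ Icc 1 (⌊KMV2000.qhat q ^ Δ'⌋₊ / (c * g)), ∑ k₂ ∈ Icc 1 (⌊KMV2000.qhat q ^ Δ'⌋₊ / (c * g)),
              ((μ (c * g * k₁) : ℝ) * ((KMV2000.psi (c * g * k₁))⁻¹ *
                  P.eval (Real.log (KMV2000.qhat q ^ Δ' / ((c * g * k₁ : ℕ) : ℝ)) / Real.log (KMV2000.qhat q ^ Δ'))) /
                  ((c * g * k₁ : ℕ) : ℝ)) *
              ((μ (c * g * k₂) : ℝ) * ((KMV2000.psi (c * g * k₂))⁻¹ *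
                  P.eval (Real.log (KMV2000.qhat q ^ Δ' / ((c * g * k₂ : ℕ) : ℝ)) / Real.log (KMV2000.qhat q ^ Δ'))) /
                  ((c * g * k₂ : ℕ) : ℝ)) *
              ∑ d ∈ k₁.divisors, ∑ e ∈ k₂.divisors,
                ∫ u₁ in Set.Ioi (0 : ℝ),
                  (Real.log (KMV2000.qhat q / ((k₁ / d * (g * e) : ℕ) : ℝ)) + Real.log u₁) ^ i *
                  ∫ u₂ in Set.Ioi ((((k₁ / d * (g * e) * (g * d * (k₂ / e)) : ℕ) : ℝ) / KMV2000.qhat q ^ 2) / u₁),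
                    Real.exp (-(u₁ + u₂)) / (1 - Real.exp (-(u₁ + u₂))) ^ 2 *
                    (Real.log (KMV2000.qhat q / ((g * d * (k₂ / e) : ℕ) : ℝ)) + Real.log u₂) ^ j) -
          2 * (π ^ 2 / 6) ^ 2 * (KMV2000.qhat q / (Δ' ^ 2 * Real.log (KMV2000.qhat q) ^ 2)) * τ i j Δ' P| ≤
          C * KMV2000.qhat q * (Real.log (KMV2000.qhat q))⁻¹ ^ 3) :
    SubDiag := by
  refine subDiag_of_selbergOrderAsymptotics hΔ1 hΔ (fun i j Δ' P ↦ if i ≤ j then τ i j Δ' P else τ j i Δ' P)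
    (fun Δ' P ↦ by simp only [le_refl, if_true]; exact h0 Δ' P) ?_
  intro i j hij hne P hP Δ' h1 h2
  by_cases hle : i ≤ j
  · simp only [hle, if_true]
    exact h i j hle hij hne P hP Δ' h1 h2
  · simp only [hle, if_false]
    have hji : j ≤ i := le_of_not_ge hle
    have hij' : Even (j + i) := by rwa [add_comm]
    have hne' : ¬(j = 0 ∧ i = 0) := fun hc ↦ hne ⟨hc.2, hc.1⟩
    obtain ⟨C, q₀, hC⟩ := h j i hji hij' hne' P hP Δ' h1 h2
    refine ⟨C, q₀, fun q _ hq ↦ ?_⟩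
    have hQ : 0 < KMV2000.qhat q := KMV2000.qhat_pos_of_neZero q
    rw [selbergOrder_symm i j P _ _ hQ, show i + j = j + i from add_comm i j]
    exact hC q hq

end Summit.Parity.GeneralizedHardyLittlewood.Theorems.MomentsBeyondDiagonal.DiagLines

end
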